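import Summits.Ventures.WeilGRH.UniformConductorFloorJointCertSoundB
import Summits.Ventures.WeilGRH.UniformConductorFloorJointEvenLog8Check
import Summits.Ventures.WeilGRH.UniformConductorFloorJointOddLog8Check
import Summits.Ventures.WeilGRH.UniformConductorFloorCellsOne
import Summits.Ventures.WeilGRH.UniformConductorFloorRungs
import HarnessLib

/-!
# GRH arm (rh-explicit, venture WeilGRH): ★ the rung `t = (log 8)/2` for EVERY Dirichlet character of EVERY modulus `q ≥ 97`
  (odd characters: `q ≥ 37`) — the joint cell certificates

Cell `rh-explicit`, WEIL TRACK — GRH ARM (weil-grh-1).  The uniform conductor floor of the arm at the rung `t = (log 8)/2 = 1.0397…`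
(the first rung beyond `[-1, 1]`, where the prime power `8` enters), from the joint cell certificates `certEvenLog8` / `certOddLog8`
(`UniformConductorFloorJointDataLog8.lean`; `R = 320`, `J = 333`, window `t = 333 log(320/319) = 1.0422 ≥ (log 8)/2`, `N = 8`),
kernel-checked in `…JointEvenLog8Check.lean` / `…JointOddLog8Check.lean`, through `JointCert.weilPositivityOnChar_of_parts`:

* ★ `weilPositivityOnChar_log8half_of_ge_97` — EVERY Dirichlet character of EVERY modulus `q ≥ 97` satisfies
  `WeilPositivityOnChar χ (log 8 / 2)` (hence every window `t ≤ (log 8)/2`, in particular `t = 1`);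
* ★ `weilPositivityOnChar_log8half_of_odd_ge_37` — every ODD character of every modulus `q ≥ 37`
  (tree before: `q ≥ 216`, `DualTrigUniversalOddLog8Half`).

Calibration: exact pseudo-key floors at this rung (EXTREMALS/GRH/trivial-key-minorant-CERT, weil-grh-2): `92` / `36`.  Inputs beyond the
certificates: `UniformFloor.wbar7_ge` (`n ≤ 7`), `Λ(8)/√8 = (log 2/√2)/2 ≤ 0.24507` (`vonMangoldt_eight`, `kprime_bounds`),
`UniformFloor.psi_even_ge` / `psi_odd_ge`, `log 97 ≥ 5 log 2 + log 3 + 1/97`, `log 37 ≥ 2 log 2 + 2 log 3 + 1/37`, and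
`8·319^666 ≤ 320^666` for the window.  Honest scope: a finite-window statement for large moduli; no `ζ` input; standard axioms.

## References

* A. Weil (1952), (11) pp. 261–262 and the «lemme» p. 262 [Weil1952FormulesExplicites]; L. Collatz (1942) / H. Wielandt (1950). [folklore]
-/

noncomputable section

open Real Set
open scoped ArithmeticFunction.vonMangoldt

namespace Summit.Ventures.WeilGRH

open Literature.NumberTheory.LFunctions

namespace UniformFloor

variable {q : ℕ}

/-! ## The transcendental inputs -/

/-- `Λ(8)/√8 ≤ 256975/2^20` (`Λ(8) = log 2`, `√8 = 2√2`, `log 2/√2 ≤ 0.49014`). [folklore] -/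
theorem vonMangoldt_eight_div_sqrt_le : (Λ 8 : ℝ) / Real.sqrt ((8 : ℕ) : ℝ) ≤ ((256975 : ℕ) : ℝ) / ((1048576 : ℕ) : ℝ) := by
  have h8 : Real.sqrt ((8 : ℕ) : ℝ) = 2 * Real.sqrt 2 := by
    rw [show ((8 : ℕ) : ℝ) = 2 ^ 2 * 2 by norm_num, Real.sqrt_mul (by norm_num), Real.sqrt_sq (by norm_num)]
  have hk := kprime_bounds.2
  have hs : 0 < Real.sqrt 2 := Real.sqrt_pos.2 (by norm_num)
  rw [vonMangoldt_eight, h8, show Real.log 2 / (2 * Real.sqrt 2) = Real.log 2 / Real.sqrt 2 / 2 by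
    rw [mul_comm, ← div_div]]
  push_cast
  linarith

/-- The weights of a `JointCert` with the standard `N = 8` table dominate `Λ(n)/√n`. [folklore] -/
theorem hw_of_weights8 (c : JointCert) (hN : c.N = 8) (hD : c.D = 1048576)
    (hW : c.weights = [0, 0, 513950, 665112, 363409, 754726, 0, 771213, 256975]) :
    ∀ n ∈ Finset.range (c.N + 1), (Λ n : ℝ) / Real.sqrt n ≤ c.wbar n := by
  intro n hn
  rw [hN] at hn
  have hn9 : n < 9 := by simpa using Finset.mem_range.1 hn
  unfold JointCert.wbar
  rw [hD, hW]
  have h7 : ∀ m < 8, (Λ m : ℝ) / Real.sqrt m ≤ wbar7 m := fun m hm ↦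
    wbar7_ge 7 le_rfl m (Finset.mem_range.2 (by omega))
  interval_cases n
  · exact (h7 0 (by norm_num)).trans (by norm_num [wbar7])
  · exact (h7 1 (by norm_num)).trans (by norm_num [wbar7])
  · exact (h7 2 (by norm_num)).trans (by norm_num [wbar7])
  · exact (h7 3 (by norm_num)).trans (by norm_num [wbar7])
  · exact (h7 4 (by norm_num)).trans (by norm_num [wbar7])
  · exact (h7 5 (by norm_num)).trans (by norm_num [wbar7])
  · exact (h7 6 (by norm_num)).trans (by norm_num [wbar7])
  · exact (h7 7 (by norm_num)).trans (by norm_num [wbar7])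
  · simpa using vonMangoldt_eight_div_sqrt_le

/-- `log 97 ≥ 5 log 2 + log 3 + 1/97` (`97 = 96·(97/96)`, `log x ≥ 1 − 1/x`). [folklore] -/
theorem log_97_ge : 5 * Real.log 2 + Real.log 3 + 1 / 97 ≤ Real.log 97 := by
  have hl : 1 - ((97 : ℝ) / 96)⁻¹ ≤ Real.log ((97 : ℝ) / 96) := Real.one_sub_inv_le_log_of_pos (by norm_num)
  rw [Real.log_div (by norm_num) (by norm_num), show (96 : ℝ) = 2 ^ 5 * 3 by norm_num,
    Real.log_mul (by norm_num) (by norm_num), Real.log_pow] at hl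
  push_cast at hl
  norm_num at hl
  linarith

/-- `log 37 ≥ 2 log 2 + 2 log 3 + 1/37` (`37 = 36·(37/36)`). [folklore] -/
theorem log_37_ge : 2 * Real.log 2 + 2 * Real.log 3 + 1 / 37 ≤ Real.log 37 := by
  have hl : 1 - ((37 : ℝ) / 36)⁻¹ ≤ Real.log ((37 : ℝ) / 36) := Real.one_sub_inv_le_log_of_pos (by norm_num)
  rw [Real.log_div (by norm_num) (by norm_num), show (36 : ℝ) = 2 ^ 2 * 3 ^ 2 by norm_num,
    Real.log_mul (by norm_num) (by norm_num), Real.log_pow, Real.log_pow] at hl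
  push_cast at hl
  norm_num at hl
  linarith

/-- The budget of `certEvenLog8`: `log π + 4.22745354 − Clow/D + RHO/D ≤ log 97`. [folklore] -/
theorem certEvenLog8_budget :
    Real.log Real.pi - (-4.22745354) - (certEvenLog8.Clow : ℝ) / certEvenLog8.D + (certEvenLog8.RHO : ℝ) / certEvenLog8.D ≤
      Real.log (97 : ℕ) := by
  have hπ := Literature.Analysis.SpecialFunctions.Real.log_pi_le
  have h2 := Real.log_two_gt_d9
  have h3 := Real.log_three_gt_d9
  have h97 := log_97_ge
  rw [show certEvenLog8.Clow = 7676640 from rfl, show certEvenLog8.D = 1048576 from rfl,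
    show certEvenLog8.RHO = 6834131 from rfl]
  push_cast
  linarith

/-- The budget of `certOddLog8`: `log π + 1.08586154 − Clow/D + RHO/D ≤ log 37`. [folklore] -/
theorem certOddLog8_budget :
    Real.log Real.pi - (-1.08586154) - (certOddLog8.Clow : ℝ) / certOddLog8.D + (certOddLog8.RHO : ℝ) / certOddLog8.D ≤
      Real.log (37 : ℕ) := by
  have hπ := Literature.Analysis.SpecialFunctions.Real.log_pi_le
  have h2 := Real.log_two_gt_d9
  have h3 := Real.log_three_gt_d9
  have h37 := log_37_ge
  rw [show certOddLog8.Clow = 4399980 from rfl, show certOddLog8.D = 1048576 from rfl,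
    show certOddLog8.RHO = 5846379 from rfl]
  push_cast
  linarith

/-! ## The window contains `[-(log 8)/2, (log 8)/2]` -/

/-- `(log 8)/2 ≤ 333 log(320/319)` (`8·319^666 ≤ 320^666`). [folklore] -/
theorem log8half_le_t (c : JointCert) (hR : c.R = 320) (hJ : c.J = 333) : Real.log 8 / 2 ≤ c.t := by
  rw [JointCert.t_eq_log, hR, hJ]
  have h : Real.log 8 ≤ Real.log (((((320 : ℕ) : ℝ) / (((320 : ℕ) : ℝ) - 1)) ^ 333) ^ 2) := by
    refine Real.log_le_log (by norm_num) ?_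
    rw [← pow_mul, div_pow, le_div_iff₀ (by norm_num)]
    have h0 : (8 : ℝ) * 319 ^ 666 ≤ 320 ^ 666 := by exact_mod_cast (by decide +kernel : 8 * 319 ^ 666 ≤ 320 ^ 666)
    norm_num
    exact h0
  rw [Real.log_pow] at h
  push_cast at h ⊢
  linarith

/-! ## The floors -/

/-- ★ Every EVEN character of every modulus `q ≥ 97` at the rung `(log 8)/2`. [folklore] -/
theorem weilPositivityOnChar_log8half_of_even_ge_97 (hq : 97 ≤ q) (χ : DirichletCharacter ℂ q) (hpar : charParity χ = 0) :
    WeilPositivityOnChar χ (Real.log 8 / 2) := by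
  have h := certEvenLog8.weilPositivityOnChar_of_parts certEvenLog8_checkFrame
    (fun _ hj ↦ certEvenLog8.cellOKB_of_checkCells certEvenLog8_checkCells hj)
    (hw_of_weights8 certEvenLog8 rfl rfl rfl) psi_even_ge (Q₀ := 97) (by norm_num) certEvenLog8_budget (by omega) hq χ hpar
  have ht := log8half_le_t certEvenLog8 rfl rfl
  exact fun g hg hsupp ↦ h g hg (hsupp.trans (Icc_subset_Icc (by linarith) ht))

/-- ★ **Every ODD character of every modulus `q ≥ 37` satisfies Weil positivity on `[-(log 8)/2, (log 8)/2]`.**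
[cite: Weil1952FormulesExplicites, (11) and the «lemme» p. 262] -/
theorem weilPositivityOnChar_log8half_of_odd_ge_37 (hq : 37 ≤ q) (χ : DirichletCharacter ℂ q) (hpar : charParity χ = 1) :
    WeilPositivityOnChar χ (Real.log 8 / 2) := by
  have h := certOddLog8.weilPositivityOnChar_of_parts certOddLog8_checkFrame
    (fun _ hj ↦ certOddLog8.cellOKB_of_checkCells certOddLog8_checkCells hj)
    (hw_of_weights8 certOddLog8 rfl rfl rfl) psi_odd_ge (Q₀ := 37) (by norm_num) certOddLog8_budget (by omega) hq χ hpar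
  have ht := log8half_le_t certOddLog8 rfl rfl
  exact fun g hg hsupp ↦ h g hg (hsupp.trans (Icc_subset_Icc (by linarith) ht))

/-- ★★ **EVERY Dirichlet character (any parity, any values, imprimitive included) of EVERY modulus `q ≥ 97` satisfies Weil
positivity on `[-(log 8)/2, (log 8)/2]`: `WeilPositivityOnChar χ (log 8 / 2)`.** [cite: Weil1952FormulesExplicites, (11) and the «lemme» p. 262] -/
theorem weilPositivityOnChar_log8half_of_ge_97 (hq : 97 ≤ q) (χ : DirichletCharacter ℂ q) :
    WeilPositivityOnChar χ (Real.log 8 / 2) := by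
  rcases Nat.le_one_iff_eq_zero_or_eq_one.1 (charParity_le_one χ) with h | h
  · exact weilPositivityOnChar_log8half_of_even_ge_97 hq χ h
  · exact weilPositivityOnChar_log8half_of_odd_ge_37 (by omega) χ h

/-- The same on every window `t ≤ (log 8)/2`. [folklore] -/
theorem weilPositivityOnChar_of_le_log8half_of_ge_97 (hq : 97 ≤ q) (χ : DirichletCharacter ℂ q) {t : ℝ}
    (ht : t ≤ Real.log 8 / 2) : WeilPositivityOnChar χ t := fun g hg hsupp ↦
  weilPositivityOnChar_log8half_of_ge_97 hq χ g hg (hsupp.trans (Icc_subset_Icc (by linarith) ht))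

/-- Odd characters on every window `t ≤ (log 8)/2` from `q ≥ 37`. [folklore] -/
theorem weilPositivityOnChar_of_le_log8half_of_odd_ge_37 (hq : 37 ≤ q) (χ : DirichletCharacter ℂ q)
    (hpar : charParity χ = 1) {t : ℝ} (ht : t ≤ Real.log 8 / 2) : WeilPositivityOnChar χ t := fun g hg hsupp ↦
  weilPositivityOnChar_log8half_of_odd_ge_37 hq χ hpar g hg (hsupp.trans (Icc_subset_Icc (by linarith) ht))

end UniformFloor

end Summit.Ventures.WeilGRH

end
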